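import Summits.QuantumFields.YangMills.Theorems.BalabanUVNodesK1AxStubCont13DoorOfKernelLetters
import Summits.QuantumFields.YangMills.Theorems.BalabanUVNodesN24Stub23VWShareK1AxV11
import Summits.QuantumFields.YangMills.Theorems.BalabanUVNodesK0RecordFormatNamesBetaKernel

/-!
# K1ᴬ (stmt-QuantumFields-27239, LINE 2′ v11.1) — THE `stub_cont13(VW)` DOORS FROM THE THREE PRIMITIVE β-KERNEL LETTERS ON A PER-θ SMALL BOX
# (the WEAKER, per-radius edition of `…K1AxStubCont13DoorOfKernelLetters`: letters asked on SOME box `]0, γc]^{k+1}`, `0 < γc ≤ θ.γ`, not on the record's whole box)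
# — AND THE SAME DOORS KEYED TO ★★ DEF-1's ED.25 LETTER NAMES `PolLimitLocUnifOnBox₁₃Ax` ∕ `PlimDecayOnBox₁₃Ax` ∕ `PvolHistContOnBox₁₃Ax` (✓p821177 `…K0RecordFormatNamesBetaKernel`)

Cell `pub-ymgap` (YM-PLAN Track A, D-0062), seat `pub-ymgap-dag-n24-c` (g25; the `-a` knit-by-name hand of LINE 2′).  `--kind proof --supports stmt-QuantumFields-27239 --as helper`;
COUNT-NEUTRAL; theorems only (0 `def`, 0 `sorry`; standard axioms).  Sequel of ✓p821319 `…K1AxStubCont13DoorOfKernelLetters` (this seat) over ★ PTB-1's ✓p820605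
`…K1AxBetaContKernel`, g24's ✓p813862 `…N24Stub23VWShareK1AxV11.stub3TextVW_of_contBill` and ★★ DEF-1's ✓p821177 `…K0RecordFormatNamesBetaKernel` (the letter NAMES; a
K0-names file never imports a K1Ax door file, so the NAMED doors live here — dag-lead WORDS 745 (2)) — all USED BY NAME, nothing re-proved.

WHY THIS FILE.  ✓p821319's doors go through the ∀θ supplier letter `K1AxV11Defs.Cont13All`, i.e. they ask the three letters ((T-β1) locally-uniform volume limit of the
windowed kernels `pvolOf → plimOf`, (T-β2) `PlimDecayOnBoxOf` with ONE `(C, δ₁)`, (T-β3) history-continuity of every finite-volume kernel entry) on the record's WHOLE box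
`]0, θ.γ]^{k+1}` at every admissible tuple.  Print's estimates behind them ([I] (1.21) p.264 «by the localized representation (1.7)», (5.10) p.293) are SMALL-COUPLING
statements: what a supplier can hope to deliver at a tuple `θ` is the three letters on SOME box `]0, γc]^{k+1}` with `0 < γc ≤ θ.γ` (γc depending on θ).  The registered stub
does not care: `stub_cont13VW : ∀ F, RunRowsAtSomeRecord13PWSVW F → RunRowsContAtSomeRecord13PWSVW F` lets the level `γ₀` of the rows be CUT (`RunConstRemainder.mono`; the floor
is antitone in the level) to `min γ₀ γc` where (C) holds — g24's kit pattern `stub3TextVW_of_contBill` (rows witness KEPT, no presenting parameter read).  So the per-radius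
letters suffice, and this file says so by name.

WHAT IS PROVED (kernel-checked bookkeeping; every analytic input a hypothesis):
§1–§2 (letter BODIES, per radius):
* ★★ `contBillAtRadius_of_kernelLettersAtRadius` — per-radius kernel letters at every rung-0 tuple (`Provisos₁₃SepCoPHAx`, `ZhUnity ∧ SlotsNondegenerate₁₃Ax`, `Admissible`) ⟹
  g24's per-θ-radius (C) bill `∃ γc > 0, ∀ γ₀, 0 < γ₀ → γ₀ ≤ γc → SurvCont (betaOfRecord₁₃Ax F 2 θ.toStage13Params) γ₀` (PTB-1's `survCont_betaOfRecord₁₃Ax_of_kernelLetters` at `γ := γc`).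
* ★★★ `stubCont13VW_of_kernelLettersAtRadius` — ⟹ THE REGISTERED TEXT of `stub_cont13VW` (g24's `stub3TextVW_of_contBill` BY NAME).
* ★★ `stubCont13_of_kernelLettersAtRadius` — ⟹ THE REGISTERED TEXT of LINE 1's `stub_cont13` (same kit pattern at `RunRowsAtSomeRecord13PWS`; eight lines, no LINE-1 twin of
  g24's lemma exists to cite).
ORDER: the whole-box letters of ✓p821319's doors ARE per-radius letters with `γc := θ.γ` (whenever `0 < θ.γ`), so this edition has the WEAKER hypothesis and the SAME conclusions.
§3 (ED.25 letter NAMES at `θ.toStage13Params`; each a definitional unfolding of the body-level door — `PolLimitLocUnifOnBox₁₃Ax F 2 ϑ γ` ∕ `PlimDecayOnBox₁₃Ax F 2 ϑ γ C δ₁` ∕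
`PvolHistContOnBox₁₃Ax F 2 ϑ γ` unfold to (T-β1) ∕ (T-β2) ∕ (T-β3) for `famOfRecord₁₃Ax F 2 ϑ = mergedTermFamilyMatT F 2 (TβOfRecord₁₃ F 2) (chiβOfRecord₁₃Ax F 2 ϑ) ϑ.εbg` in the chart
`(ϑ.ρ8, ϑ.bV)`): ★★★ `cont13All_of_letters₁₃Ax` (whole box `θ.γ` ⟹ `Cont13All`) · ★★★ `stubCont13VW_of_letters₁₃Ax` ∕ `stubCont13_of_letters₁₃Ax` (whole box ⟹ the registered
texts) · ★★★ `stubCont13VW_of_letters₁₃AxAtRadius` ∕ `stubCont13_of_letters₁₃AxAtRadius` (per-radius NAMED letters `∃ γc, 0 < γc ∧ γc ≤ θ.γ ∧ PolLimitLocUnifOnBox₁₃Ax … γc ∧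
(∃ C δ₁, PlimDecayOnBox₁₃Ax … γc C δ₁) ∧ PvolHistContOnBox₁₃Ax … γc` ⟹ the registered texts) — the shapes ✦ plan's v11.2 display can cite BY NAME.

HONEST FRAMING (binding).  CONDITIONAL helpers: the three letters (on any box) are HYPOTHESES discharged by nobody — (T-β1)(T-β2) Bałaban-strength ([I] (1.21) uniformity,
(5.10)), (T-β3) the outright-provable finite-volume item (`K0AxMomentRoad.continuousOn_polWindow_of_hessCont` road).  `stub_cont13VW` ∕ `stub_cont13` stay OPEN; K1ᴬ
stmt-QuantumFields-27239 OPEN (v11.1 stubs 0∕6); K0ᴬ ∕ K3ᴬ OPEN; COUNT 8∕27 (A 8∕28) · K 1∕4 UNMOVED; R4 = the conditional finite-𝕋⁴ rung `BalabanLadder.UV` at fixed `ε = L^(−K)`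
only — NOT continuum ∕ ℝ⁴ ∕ OS; the Yang–Mills mass gap (Clay) is NOT proved by any of this.
-/

noncomputable section

open Filter Topology
open scoped BigOperators Matrix.Norms.L2Operator

namespace Summit.QuantumFields.YangMills.Theorems.K1AxStubCont13DoorOfKernelLetters

open Literature.MathematicalPhysics.QuantumFieldTheory.Balaban1983to89
open Literature.MathematicalPhysics.QuantumFieldTheory.Balaban1983to89.Node00
open Literature.MathematicalPhysics.QuantumFieldTheory.Balaban1983to89.T4Continuum (T4Family)
open Literature.MathematicalPhysics.QuantumFieldTheory.Balaban1983to89.FlowStep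
open Summit.QuantumFields.YangMills.Theorems.K0RecordFormatNames (pvolOf plimOf PlimDecayOnBoxOf)
open Summit.QuantumFields.YangMills.Theorems.BalabanUVNodesK2NamedJetsRunRemAt (SurvCont RunConstRemainder.mono)
open Summit.QuantumFields.YangMills.Theorems.K1AxBetaContKernel (survCont_betaOfRecord₁₃Ax_of_kernelLetters)
open Summit.QuantumFields.YangMills.Theorems.K1AxV11Defs (Cont13All RunRowsAtSomeRecord13PWSVW RunRowsContAtSomeRecord13PWSVW RunRowsAtSomeRecord13PWS RunRowsContAtSomeRecord13PWS)
open Summit.QuantumFields.YangMills.BalabanUVNodes.N24Stub23VWShareK1AxV11 (stub3TextVW_of_contBill)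

/-! ## §1  Per-radius kernel letters at every rung-0 tuple ⟹ g24's per-θ-radius (C) bill -/

/-- ★★ **THE PER-θ-RADIUS (C) BILL FROM PER-RADIUS KERNEL LETTERS**: if at EVERY rung-0 tuple `θ` (N = 2: re-centred provisos, partition of unity ∧ non-degenerate slots, admissible)
there is SOME box side `0 < γc ≤ θ.γ` on which the windowed finite-volume kernels of the re-centred merged term of record (i) converge locally uniformly in the history to the limit
kernel, every scale and site ((T-β1)), (ii) the limit kernel obeys (5.10) with ONE `(C, δ₁)` ((T-β2)), and (iii) every finite-volume kernel entry is continuous in the history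
((T-β3)) — THEN at every such `θ` the record's β has run-wise SURVIVOR CONTINUITY `SurvCont (betaOfRecord₁₃Ax F 2 θ.toStage13Params) γ₀` at every level `0 < γ₀ ≤ γc`
(PTB-1's `K1AxBetaContKernel.survCont_betaOfRecord₁₃Ax_of_kernelLetters` at `γ := γc`).  CONDITIONAL; nothing asserted.
[cite: Balaban1987RG1, §1 pp.263–264, (1.20)–(1.22) p.264, (2.9) p.266, (5.10) p.293] -/
theorem contBillAtRadius_of_kernelLettersAtRadius
    (H : ∀ (F : T4Family) (θ : Node00.Stage13HParams F 2), θ.Provisos₁₃SepCoPHAx F 2 → (θ.ZhUnity F 2 ∧ θ.SlotsNondegenerate₁₃Ax F 2) → θ.Admissible F 2 →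
      ∃ γc : ℝ, 0 < γc ∧ γc ≤ θ.γ ∧
      letI := θ.instVβ₁; letI := θ.instVβ₂; letI := θ.instιβ
      (∀ (k : ℕ) (z : Fin 4 → ℤ), TendstoLocallyUniformlyOn
          (fun (K : ℕ) (v : Fin (k + 1) → ℝ) =>
            pvolOf F (mergedTermFamilyMatT F 2 (TβOfRecord₁₃ F 2) (chiβOfRecord₁₃Ax F 2 θ.toStage13Params) θ.εbg) θ.ρ8 θ.bV k v K 0 1 z)
          (fun v : Fin (k + 1) → ℝ =>
            plimOf F (mergedTermFamilyMatT F 2 (TβOfRecord₁₃ F 2) (chiβOfRecord₁₃Ax F 2 θ.toStage13Params) θ.εbg) θ.ρ8 θ.bV k v 0 1 z)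
          atTop (Box γc k)) ∧
      (∃ C δ₁ : ℝ, PlimDecayOnBoxOf F (mergedTermFamilyMatT F 2 (TβOfRecord₁₃ F 2) (chiβOfRecord₁₃Ax F 2 θ.toStage13Params) θ.εbg) θ.ρ8 θ.bV γc C δ₁) ∧
      (∀ (k K : ℕ) (z : Fin 4 → ℤ), ContinuousOn (fun v : Fin (k + 1) → ℝ =>
          pvolOf F (mergedTermFamilyMatT F 2 (TβOfRecord₁₃ F 2) (chiβOfRecord₁₃Ax F 2 θ.toStage13Params) θ.εbg) θ.ρ8 θ.bV k v K 0 1 z) (Box γc k))) :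
    ∀ (F : T4Family) (θ : Node00.Stage13HParams F 2), θ.Provisos₁₃SepCoPHAx F 2 → (θ.ZhUnity F 2 ∧ θ.SlotsNondegenerate₁₃Ax F 2) → θ.Admissible F 2 →
      ∃ γc : ℝ, 0 < γc ∧ ∀ γ₀ : ℝ, 0 < γ₀ → γ₀ ≤ γc → SurvCont (betaOfRecord₁₃Ax F 2 θ.toStage13Params) γ₀ := by
  intro F θ hP hU hA
  letI := θ.instVβ₁; letI := θ.instVβ₂; letI := θ.instιβ
  obtain ⟨γc, hγc, hγcle, h1, ⟨C, δ₁, h2⟩, h3⟩ := H F θ hP hU hA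
  exact ⟨γc, hγc, fun γ₀ hγ₀ hle => survCont_betaOfRecord₁₃Ax_of_kernelLetters θ.toStage13Params hγ₀ hle hγcle h1 h2 h3⟩

/-! ## §2  The doors: the REGISTERED texts of `stub_cont13VW` (LINE 2′) and `stub_cont13` (LINE 1) from per-radius kernel letters -/

/-- ★★★ **THE REGISTERED TEXT OF `stub_cont13VW` FROM PER-RADIUS KERNEL LETTERS** — rows witness KEPT, rows cut to `min γ₀ γc`, (C) attached there (g24's
`N24Stub23VWShareK1AxV11.stub3TextVW_of_contBill` BY NAME after §1).  WEAKER hypothesis than ✓p821319's `stubCont13VW_of_kernelLetters` (letters on SOME small box per tuple,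
not on `]0, θ.γ]`), SAME conclusion.  CONDITIONAL — the stub stays OPEN until the letters are proved. [cite: Balaban1987RG1, §1 pp.263–264, Thm 3 p.264, (1.20)–(1.22) p.264, (5.10) p.293] -/
theorem stubCont13VW_of_kernelLettersAtRadius
    (H : ∀ (F : T4Family) (θ : Node00.Stage13HParams F 2), θ.Provisos₁₃SepCoPHAx F 2 → (θ.ZhUnity F 2 ∧ θ.SlotsNondegenerate₁₃Ax F 2) → θ.Admissible F 2 →
      ∃ γc : ℝ, 0 < γc ∧ γc ≤ θ.γ ∧
      letI := θ.instVβ₁; letI := θ.instVβ₂; letI := θ.instιβ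
      (∀ (k : ℕ) (z : Fin 4 → ℤ), TendstoLocallyUniformlyOn
          (fun (K : ℕ) (v : Fin (k + 1) → ℝ) =>
            pvolOf F (mergedTermFamilyMatT F 2 (TβOfRecord₁₃ F 2) (chiβOfRecord₁₃Ax F 2 θ.toStage13Params) θ.εbg) θ.ρ8 θ.bV k v K 0 1 z)
          (fun v : Fin (k + 1) → ℝ =>
            plimOf F (mergedTermFamilyMatT F 2 (TβOfRecord₁₃ F 2) (chiβOfRecord₁₃Ax F 2 θ.toStage13Params) θ.εbg) θ.ρ8 θ.bV k v 0 1 z)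
          atTop (Box γc k)) ∧
      (∃ C δ₁ : ℝ, PlimDecayOnBoxOf F (mergedTermFamilyMatT F 2 (TβOfRecord₁₃ F 2) (chiβOfRecord₁₃Ax F 2 θ.toStage13Params) θ.εbg) θ.ρ8 θ.bV γc C δ₁) ∧
      (∀ (k K : ℕ) (z : Fin 4 → ℤ), ContinuousOn (fun v : Fin (k + 1) → ℝ =>
          pvolOf F (mergedTermFamilyMatT F 2 (TβOfRecord₁₃ F 2) (chiβOfRecord₁₃Ax F 2 θ.toStage13Params) θ.εbg) θ.ρ8 θ.bV k v K 0 1 z) (Box γc k))) :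
    ∀ F : T4Family, RunRowsAtSomeRecord13PWSVW F → RunRowsContAtSomeRecord13PWSVW F :=
  stub3TextVW_of_contBill (contBillAtRadius_of_kernelLettersAtRadius H)

/-- ★★ **THE REGISTERED TEXT OF LINE 1's `stub_cont13` FROM PER-RADIUS KERNEL LETTERS** (the same kit pattern at `RunRowsAtSomeRecord13PWS`: keep the witness `(θ, h, w)`, cut
the rows to `min γ₀ γc` by `RunConstRemainder.mono` and the antitone floor, attach (C) from §1 there).  CONDITIONAL.
[cite: Balaban1987RG1, §1 pp.263–264, Thm 3 p.264, (1.20)–(1.22) p.264, (5.10) p.293] -/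
theorem stubCont13_of_kernelLettersAtRadius
    (H : ∀ (F : T4Family) (θ : Node00.Stage13HParams F 2), θ.Provisos₁₃SepCoPHAx F 2 → (θ.ZhUnity F 2 ∧ θ.SlotsNondegenerate₁₃Ax F 2) → θ.Admissible F 2 →
      ∃ γc : ℝ, 0 < γc ∧ γc ≤ θ.γ ∧
      letI := θ.instVβ₁; letI := θ.instVβ₂; letI := θ.instιβ
      (∀ (k : ℕ) (z : Fin 4 → ℤ), TendstoLocallyUniformlyOn
          (fun (K : ℕ) (v : Fin (k + 1) → ℝ) =>
            pvolOf F (mergedTermFamilyMatT F 2 (TβOfRecord₁₃ F 2) (chiβOfRecord₁₃Ax F 2 θ.toStage13Params) θ.εbg) θ.ρ8 θ.bV k v K 0 1 z)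
          (fun v : Fin (k + 1) → ℝ =>
            plimOf F (mergedTermFamilyMatT F 2 (TβOfRecord₁₃ F 2) (chiβOfRecord₁₃Ax F 2 θ.toStage13Params) θ.εbg) θ.ρ8 θ.bV k v 0 1 z)
          atTop (Box γc k)) ∧
      (∃ C δ₁ : ℝ, PlimDecayOnBoxOf F (mergedTermFamilyMatT F 2 (TβOfRecord₁₃ F 2) (chiβOfRecord₁₃Ax F 2 θ.toStage13Params) θ.εbg) θ.ρ8 θ.bV γc C δ₁) ∧
      (∀ (k K : ℕ) (z : Fin 4 → ℤ), ContinuousOn (fun v : Fin (k + 1) → ℝ =>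
          pvolOf F (mergedTermFamilyMatT F 2 (TβOfRecord₁₃ F 2) (chiβOfRecord₁₃Ax F 2 θ.toStage13Params) θ.εbg) θ.ρ8 θ.bV k v K 0 1 z) (Box γc k))) :
    ∀ F : T4Family, RunRowsAtSomeRecord13PWS F → RunRowsContAtSomeRecord13PWS F := by
  intro F hrows
  obtain ⟨θ, h, w, hU, hθ, hR, hnodes, b, r, γ₀, B, M, hγ₀, hrem, hB, hmatch, hps⟩ := hrows
  obtain ⟨γc, hγc, hsc⟩ := contBillAtRadius_of_kernelLettersAtRadius H F θ h hU hθ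
  have hγ₁ : 0 < min γ₀ γc := lt_min hγ₀ hγc
  refine ⟨θ, h, w, hU, hθ, hR, hnodes, b, r, min γ₀ γc, B, M, hγ₁, hrem.mono (min_le_left _ _), hB, hmatch, ?_, hsc _ hγ₁ (min_le_right _ _)⟩
  intro n gs hrg hI k hk
  exact hps n gs hrg (fun j hj => ⟨(hI j hj).1, (hI j hj).2.trans (min_le_left _ _)⟩) k hk


/-! ## §3  THE SAME DOORS KEYED TO ★★ DEF-1's ED.25 LETTER NAMES (`…K0RecordFormatNamesBetaKernel`: `PolLimitLocUnifOnBox₁₃Ax` ∕ `PlimDecayOnBox₁₃Ax` ∕ `PvolHistContOnBox₁₃Ax`) -/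

section Named

open Summit.QuantumFields.YangMills.Theorems.K0RecordFormatNames (PolLimitLocUnifOnBox₁₃Ax PlimDecayOnBox₁₃Ax PvolHistContOnBox₁₃Ax)

/-- ★★★ **`Cont13All` FROM THE THREE NAMED LETTERS ON THE WHOLE BOX `θ.γ` at every admissible re-centred tuple** (`cont13All_of_kernelLetters` of ✓p821319 with DEF-1's
ED.25 names; the names unfold definitionally to the letter bodies).  CONDITIONAL; nothing asserted. [cite: Balaban1987RG1, §1 pp.263–264, (1.20)–(1.22) p.264, (2.9) p.266, (5.10) p.293] -/
theorem cont13All_of_letters₁₃Ax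
    (H : ∀ (F : T4Family) (θ : Node00.Stage13HParams F 2), θ.Provisos₁₃SepCoPHAx F 2 → θ.Admissible F 2 →
      PolLimitLocUnifOnBox₁₃Ax F 2 θ.toStage13Params θ.γ ∧ (∃ C δ₁ : ℝ, PlimDecayOnBox₁₃Ax F 2 θ.toStage13Params θ.γ C δ₁) ∧
      PvolHistContOnBox₁₃Ax F 2 θ.toStage13Params θ.γ) :
    Cont13All :=
  cont13All_of_kernelLetters H

/-- ★★★ **THE REGISTERED TEXT OF `stub_cont13VW` FROM THE THREE NAMED LETTERS ON THE WHOLE BOX** (via `Cont13All`).  CONDITIONAL.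
[cite: Balaban1987RG1, §1 pp.263–264, Thm 3 p.264, (1.20)–(1.22) p.264, (5.10) p.293] -/
theorem stubCont13VW_of_letters₁₃Ax
    (H : ∀ (F : T4Family) (θ : Node00.Stage13HParams F 2), θ.Provisos₁₃SepCoPHAx F 2 → θ.Admissible F 2 →
      PolLimitLocUnifOnBox₁₃Ax F 2 θ.toStage13Params θ.γ ∧ (∃ C δ₁ : ℝ, PlimDecayOnBox₁₃Ax F 2 θ.toStage13Params θ.γ C δ₁) ∧
      PvolHistContOnBox₁₃Ax F 2 θ.toStage13Params θ.γ) :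
    ∀ F : T4Family, RunRowsAtSomeRecord13PWSVW F → RunRowsContAtSomeRecord13PWSVW F :=
  stubCont13VW_of_kernelLetters H

/-- **… and LINE 1's `stub_cont13` text from the three NAMED letters on the whole box.**  CONDITIONAL. [cite: Balaban1987RG1, §1 pp.263–264, Thm 3 p.264, (1.20)–(1.22) p.264, (5.10) p.293] -/
theorem stubCont13_of_letters₁₃Ax
    (H : ∀ (F : T4Family) (θ : Node00.Stage13HParams F 2), θ.Provisos₁₃SepCoPHAx F 2 → θ.Admissible F 2 →
      PolLimitLocUnifOnBox₁₃Ax F 2 θ.toStage13Params θ.γ ∧ (∃ C δ₁ : ℝ, PlimDecayOnBox₁₃Ax F 2 θ.toStage13Params θ.γ C δ₁) ∧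
      PvolHistContOnBox₁₃Ax F 2 θ.toStage13Params θ.γ) :
    ∀ F : T4Family, RunRowsAtSomeRecord13PWS F → RunRowsContAtSomeRecord13PWS F :=
  stubCont13_of_kernelLetters H

/-- ★★★ **THE REGISTERED TEXT OF `stub_cont13VW` FROM THE THREE NAMED LETTERS ON A PER-θ SMALL BOX** `]0, γc]`, `0 < γc ≤ θ.γ`, at every rung-0 tuple (§2 with DEF-1's ED.25
names) — the WEAKEST of this file's four VW doors and the shape a small-coupling supplier pays.  CONDITIONAL — the stub stays OPEN until the letters are proved.
[cite: Balaban1987RG1, §1 pp.263–264, Thm 3 p.264, (1.20)–(1.22) p.264, (5.10) p.293] -/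
theorem stubCont13VW_of_letters₁₃AxAtRadius
    (H : ∀ (F : T4Family) (θ : Node00.Stage13HParams F 2), θ.Provisos₁₃SepCoPHAx F 2 → (θ.ZhUnity F 2 ∧ θ.SlotsNondegenerate₁₃Ax F 2) → θ.Admissible F 2 →
      ∃ γc : ℝ, 0 < γc ∧ γc ≤ θ.γ ∧ PolLimitLocUnifOnBox₁₃Ax F 2 θ.toStage13Params γc ∧ (∃ C δ₁ : ℝ, PlimDecayOnBox₁₃Ax F 2 θ.toStage13Params γc C δ₁) ∧
        PvolHistContOnBox₁₃Ax F 2 θ.toStage13Params γc) :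
    ∀ F : T4Family, RunRowsAtSomeRecord13PWSVW F → RunRowsContAtSomeRecord13PWSVW F :=
  stubCont13VW_of_kernelLettersAtRadius H

/-- **… and LINE 1's `stub_cont13` text from the three NAMED letters on a per-θ small box.**  CONDITIONAL.
[cite: Balaban1987RG1, §1 pp.263–264, Thm 3 p.264, (1.20)–(1.22) p.264, (5.10) p.293] -/
theorem stubCont13_of_letters₁₃AxAtRadius
    (H : ∀ (F : T4Family) (θ : Node00.Stage13HParams F 2), θ.Provisos₁₃SepCoPHAx F 2 → (θ.ZhUnity F 2 ∧ θ.SlotsNondegenerate₁₃Ax F 2) → θ.Admissible F 2 →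
      ∃ γc : ℝ, 0 < γc ∧ γc ≤ θ.γ ∧ PolLimitLocUnifOnBox₁₃Ax F 2 θ.toStage13Params γc ∧ (∃ C δ₁ : ℝ, PlimDecayOnBox₁₃Ax F 2 θ.toStage13Params γc C δ₁) ∧
        PvolHistContOnBox₁₃Ax F 2 θ.toStage13Params γc) :
    ∀ F : T4Family, RunRowsAtSomeRecord13PWS F → RunRowsContAtSomeRecord13PWS F :=
  stubCont13_of_kernelLettersAtRadius H

end Named

end Summit.QuantumFields.YangMills.Theorems.K1AxStubCont13DoorOfKernelLetters

end
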